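import Mathlib
import Summits.CriticalPhenomena.Ising3DConformalLimit.Theorems.MarkovRigidityFieldRealisationMomentLimit
import Summits.CriticalPhenomena.Ising3DConformalLimit.Theorems.MarkovRigidityFieldRealisationWeakLimits
import Literature.MathematicalPhysics.QuantumLattice.RandomFieldProofs
import Literature.Probability.LatticeModels.FieldScalingLimitTrivialityProofs
import HarnessLib

/-!
# Route MarkovRigidity, support item `FieldRealisation` (stmt-CriticalPhenomena-11245):
# moments, exponential moments and moment densities of the continuum law

Helper towards clause (b) of `FieldRealisation`.  Let `μ` be a limit in law of the smeared critical
fields `P_δ` (`exists_limitLaw`).  By Lévy–Cramér–Wold on the nuclear space `𝒮` (tree: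
`tendstoInLaw_iff_fdd_holds`) all finite-dimensional marginals `(ω(f₁),…,ω(fₙ))` converge weakly,
and the uniform Gaussian bounds on the even moments of the `P_δ` (`eventually_even_moment_le`) make
every polynomial observable uniformly square integrable.  Hence (`MarkovRigidityFieldRealisationWeakLimits`):

* `integral_eval_pow_even_le` — `∫ ω(f)^{2k} dμ ≤ (2k)!/(2ᵏk!) Wᵏ` with `ω(f)^{2k}` integrable;
* `hasAllMoments_limitLaw`, `integrable_exp_eval_limitLaw` — all moments and all exponential
  moments of `μ` exist (Newman's Gaussian domination passes to the limit);
* `moment_limitLaw_eq` — the MOMENT DENSITIES of `μ` are the scaling limit: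
  `E_μ[∏ᵢ ω(fᵢ)] = ∫ (∏ᵢ fᵢ(xᵢ)) Sₙ(x) dx`.

References: Glimm–Jaffe 1987 §6.1; Billingsley 1999 Thm. 3.5; Newman 1975.  No definitions.
-/

noncomputable section

namespace Summit.CriticalPhenomena.Ising3DConformalLimit.MarkovRigidityFieldRealisation

open MeasureTheory Filter Complex Literature.Probability.LatticeModels
  Literature.MathematicalPhysics.QuantumLattice
open Summit.CriticalPhenomena.Ising3DConformalLimit
open scoped Topology Nat ENNReal

variable {ρ : ℝ → ℝ} {Δ : ℝ} {S : CorrFamily 3}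
variable {ν : Measure (SpinConfig (Site 3))} [IsProbabilityMeasure ν]
variable {L : ℝ → ℕ}
variable {μ : Measure (FieldConfig (EuclideanSpace ℝ (Fin 3)))} [IsProbabilityMeasure μ]

/-! ### Finite-dimensional marginals converge -/

/-- **Weak convergence of the finite-dimensional marginals** of the smeared laws to those of a
limit in law `μ` (Lévy's continuity theorem and Cramér–Wold along the countably generated filter
`𝓝[>] 0`; tree `tendstoInLaw_iff_fdd_holds`). [cite: BillingsleyCPM1999, §1] -/
theorem tendsto_map_fddMap
    (hlaw : TendstoInLaw (fun δ => spinFieldLaw ν (box 3 (L δ)) δ (ρ δ)) (𝓝[>] 0) μ)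
    {n : ℕ} (f : Fin n → SchwartzMap (EuclideanSpace ℝ (Fin 3)) ℝ) :
    Tendsto (fun δ => ProbabilityMeasure.map
        (⟨spinFieldLaw ν (box 3 (L δ)) δ (ρ δ), inferInstance⟩ :
          ProbabilityMeasure (FieldConfig (EuclideanSpace ℝ (Fin 3))))
        (measurable_fddMap f).aemeasurable) (𝓝[>] 0)
      (𝓝 (ProbabilityMeasure.map
        (⟨μ, inferInstance⟩ : ProbabilityMeasure (FieldConfig (EuclideanSpace ℝ (Fin 3))))
        (measurable_fddMap f).aemeasurable)) :=
  (tendstoInLaw_iff_fdd_holds (E := EuclideanSpace ℝ (Fin 3))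
    (fun δ => (⟨spinFieldLaw ν (box 3 (L δ)) δ (ρ δ), inferInstance⟩ :
      ProbabilityMeasure (FieldConfig (EuclideanSpace ℝ (Fin 3))))) (𝓝[>] (0 : ℝ))
    ⟨μ, inferInstance⟩).1 hlaw n f

/-! ### Even moments and exponential moments of the limit -/

/-- A product of `n ≥ 1` nonnegative reals is at most the sum of their `n`-th powers. [folklore] -/
theorem prod_le_sum_pow {n : ℕ} (hn : 0 < n) (a : Fin n → ℝ) (ha : ∀ i, 0 ≤ a i) :
    ∏ i, a i ≤ ∑ i, a i ^ n := by
  haveI : Nonempty (Fin n) := ⟨⟨0, hn⟩⟩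
  obtain ⟨j, -, hj⟩ := Finset.exists_max_image Finset.univ a Finset.univ_nonempty
  calc ∏ i, a i ≤ ∏ _i : Fin n, a j := Finset.prod_le_prod (fun i _ => ha i) fun i _ => hj i (Finset.mem_univ i)
    _ = a j ^ n := by rw [Finset.prod_const, Finset.card_univ, Fintype.card_fin]
    _ ≤ ∑ i, a i ^ n := Finset.single_le_sum (f := fun i => a i ^ n)
        (fun i _ => pow_nonneg (ha i) n) (Finset.mem_univ j)

/-- **Gaussian domination of the even moments of the limit law**: for every test function `f` and
every `k`, `ω(f)^{2k}` is `μ`-integrable and `∫ ω(f)^{2k} dμ ≤ (2k)!/(2ᵏk!) Wᵏ`,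
`W = 1 + ∫ |f|⊗|f| S₂`. [cite: GlimmJaffe1987, §6.1] -/
theorem integral_eval_pow_even_le (hlim : HasPointwiseScalingLimit (criticalCorr 3) ρ S)
    (hnd : IsNondegenerateTwoPoint S) (hsc : IsScaleCovariant Δ S) (hΔ0 : 0 < Δ) (hΔ : Δ < 3 / 2)
    (hν : ∀ A : Finset (Site 3), spinCorr ν A = plusCorr 3 (criticalBeta 3) 0 A)
    (hL : Tendsto (fun δ => δ * L δ) (𝓝[>] 0) atTop)
    (hlaw : TendstoInLaw (fun δ => spinFieldLaw ν (box 3 (L δ)) δ (ρ δ)) (𝓝[>] 0) μ)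
    (f : SchwartzMap (EuclideanSpace ℝ (Fin 3)) ℝ) (k : ℕ) :
    Integrable (fun ω : FieldConfig (EuclideanSpace ℝ (Fin 3)) => (ω f) ^ (2 * k)) μ ∧
      ∫ ω, (ω f) ^ (2 * k) ∂μ ≤ ((2 * k)! : ℝ) / (2 ^ k * k !) *
        (1 + ∫ x : Fin 2 → EuclideanSpace ℝ (Fin 3), (∏ i, |f (x i)|) * S 2 x) ^ k := by
  -- one-dimensional marginals through `fddMap (fun _ : Fin 1 => f)`
  have hfdd := tendsto_map_fddMap hlaw (fun _ : Fin 1 => f)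
  have hev := eventually_even_moment_le hlim hnd hsc hΔ0 hΔ hν hL f
  set g : (Fin 1 → ℝ) → ℝ := fun y => (y 0) ^ k with hg
  have hgc : Continuous g := (continuous_apply 0).pow k
  -- second-moment bound for `g` under the marginals of `P_δ`
  have hK : ∀ᶠ δ in 𝓝[>] (0 : ℝ), Integrable (fun y => g y ^ 2)
      ((ProbabilityMeasure.map ⟨spinFieldLaw ν (box 3 (L δ)) δ (ρ δ), inferInstance⟩ (measurable_fddMap (fun _ : Fin 1 => f)).aemeasurable :
            ProbabilityMeasure (Fin 1 → ℝ)) : Measure (Fin 1 → ℝ)) ∧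
      ∫ y, g y ^ 2 ∂((ProbabilityMeasure.map ⟨spinFieldLaw ν (box 3 (L δ)) δ (ρ δ), inferInstance⟩ (measurable_fddMap (fun _ : Fin 1 => f)).aemeasurable :
            ProbabilityMeasure (Fin 1 → ℝ)) : Measure (Fin 1 → ℝ)) ≤
        ((2 * k)! : ℝ) / (2 ^ k * k !) *
          (1 + ∫ x : Fin 2 → EuclideanSpace ℝ (Fin 3), (∏ i, |f (x i)|) * S 2 x) ^ k := by
    filter_upwards [hev] with δ hδ
    have hmap : ∀ F : (Fin 1 → ℝ) → ℝ, Continuous F →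
        ∫ y, F y ∂((ProbabilityMeasure.map ⟨spinFieldLaw ν (box 3 (L δ)) δ (ρ δ), inferInstance⟩ (measurable_fddMap (fun _ : Fin 1 => f)).aemeasurable :
              ProbabilityMeasure (Fin 1 → ℝ)) : Measure (Fin 1 → ℝ)) =
          ∫ ω, F (fddMap (fun _ : Fin 1 => f) ω) ∂(spinFieldLaw ν (box 3 (L δ)) δ (ρ δ)) := by
      intro F hF
      rw [ProbabilityMeasure.toMeasure_map]
      exact integral_map (measurable_fddMap _).aemeasurable hF.aestronglyMeasurable
    constructor
    · rw [ProbabilityMeasure.toMeasure_map]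
      refine (integrable_map_measure (hgc.fun_pow 2).aestronglyMeasurable
        (measurable_fddMap _).aemeasurable).2 ?_
      refine (integrable_spinFieldLaw_eval_iff ν (box 3 (L δ)) δ (ρ δ) f (continuous_pow (2 * k))).2
        (Integrable.of_bound ?_ ((∑ x ∈ box 3 (L δ), |ρ δ * δ ^ 3 * f (δ • siteToE x)|) ^ (2 * k))
          (Eventually.of_forall fun σ => ?_)) |>.congr (Eventually.of_forall fun ω => ?_)
      · exact (((measurable_eval f).comp (measurable_spinField _ δ (ρ δ))).pow_const _).aestronglyMeasurable
      · rw [Real.norm_eq_abs, abs_pow]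
        exact pow_le_pow_left₀ (abs_nonneg _) (abs_spinField_apply_le _ δ (ρ δ) σ f) _
      · simp only [Function.comp_apply, hg, fddMap_apply]; ring
    · rw [hmap _ (hgc.fun_pow 2)]
      simp only [hg, fddMap_apply, ← pow_mul, mul_comm k 2]
      exact hδ k |>.2
  obtain ⟨hmem, hle⟩ := sq_integral_le_of_tendsto hfdd hgc hK
  have hmapμ : ∀ F : (Fin 1 → ℝ) → ℝ, Continuous F →
      ∫ y, F y ∂((ProbabilityMeasure.map ⟨μ, inferInstance⟩ (measurable_fddMap (fun _ : Fin 1 => f)).aemeasurable : ProbabilityMeasure (Fin 1 → ℝ)) :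
          Measure (Fin 1 → ℝ)) = ∫ ω, F (fddMap (fun _ : Fin 1 => f) ω) ∂μ := by
    intro F hF
    rw [ProbabilityMeasure.toMeasure_map]
    exact integral_map (measurable_fddMap _).aemeasurable hF.aestronglyMeasurable
  have hint : Integrable (fun ω : FieldConfig (EuclideanSpace ℝ (Fin 3)) => (ω f) ^ (2 * k)) μ := by
    have h := (memLp_two_iff_integrable_sq hgc.aestronglyMeasurable).1 hmem
    rw [ProbabilityMeasure.toMeasure_map] at h
    have h' := (integrable_map_measure (hgc.fun_pow 2).aestronglyMeasurable
      (measurable_fddMap _).aemeasurable).1 h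
    refine h'.congr (Eventually.of_forall fun ω => ?_)
    simp only [Function.comp_apply, hg, fddMap_apply]; ring
  refine ⟨hint, ?_⟩
  rw [hmapμ _ (hgc.fun_pow 2)] at hle
  simpa only [hg, fddMap_apply, ← pow_mul, mul_comm k 2] using hle

/-- **All moments of the limit law exist.** [cite: GlimmJaffe1987, §6.1] -/
theorem hasAllMoments_limitLaw (hlim : HasPointwiseScalingLimit (criticalCorr 3) ρ S)
    (hnd : IsNondegenerateTwoPoint S) (hsc : IsScaleCovariant Δ S) (hΔ0 : 0 < Δ) (hΔ : Δ < 3 / 2)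
    (hν : ∀ A : Finset (Site 3), spinCorr ν A = plusCorr 3 (criticalBeta 3) 0 A)
    (hL : Tendsto (fun δ => δ * L δ) (𝓝[>] 0) atTop)
    (hlaw : TendstoInLaw (fun δ => spinFieldLaw ν (box 3 (L δ)) δ (ρ δ)) (𝓝[>] 0) μ) :
    HasAllMoments μ := by
  intro p f
  -- `2k ≥ p`
  obtain ⟨k, hk⟩ := exists_nat_ge (p : ℝ)
  have hint := (integral_eval_pow_even_le hlim hnd hsc hΔ0 hΔ hν hL hlaw f k).1
  have hmem : MemLp (fun ω : FieldConfig (EuclideanSpace ℝ (Fin 3)) => ω f) ((2 * k : ℕ) : ℝ≥0∞) μ := by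
    rcases Nat.eq_zero_or_pos k with rfl | hkpos
    · simp only [Nat.mul_zero, Nat.cast_zero]
      exact memLp_zero_iff_aestronglyMeasurable.2 (measurable_eval f).aestronglyMeasurable
    · refine (integrable_norm_rpow_iff (measurable_eval f).aestronglyMeasurable
        (Nat.cast_ne_zero.2 (by omega)) (ENNReal.natCast_ne_top _)).1
        (hint.congr (Eventually.of_forall fun ω => ?_))
      dsimp only
      rw [ENNReal.toReal_natCast, Real.rpow_natCast, Real.norm_eq_abs, pow_mul, pow_mul, sq_abs]
  refine hmem.mono_exponent ?_
  have : ((p : ℝ≥0∞)) ≤ ((2 * k : ℕ) : ℝ≥0∞) := by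
    have h1 : (p : ℝ) ≤ (2 * k : ℕ) := by push_cast; linarith
    exact_mod_cast h1
  exact this

/-- **All exponential moments of the limit law exist**: `exp(ω(f))` is `μ`-integrable for every test
function `f`. [cite: GlimmJaffe1987, §6.1] -/
theorem integrable_exp_eval_limitLaw (hlim : HasPointwiseScalingLimit (criticalCorr 3) ρ S)
    (hnd : IsNondegenerateTwoPoint S) (hsc : IsScaleCovariant Δ S) (hΔ0 : 0 < Δ) (hΔ : Δ < 3 / 2)
    (hν : ∀ A : Finset (Site 3), spinCorr ν A = plusCorr 3 (criticalBeta 3) 0 A)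
    (hL : Tendsto (fun δ => δ * L δ) (𝓝[>] 0) atTop)
    (hlaw : TendstoInLaw (fun δ => spinFieldLaw ν (box 3 (L δ)) δ (ρ δ)) (𝓝[>] 0) μ)
    (f : SchwartzMap (EuclideanSpace ℝ (Fin 3)) ℝ) :
    Integrable (fun ω : FieldConfig (EuclideanSpace ℝ (Fin 3)) => Real.exp (ω f)) μ := by
  have h := fun k => integral_eval_pow_even_le hlim hnd hsc hΔ0 hΔ hν hL hlaw f k
  have hW : 0 ≤ 1 + ∫ x : Fin 2 → EuclideanSpace ℝ (Fin 3), (∏ i, |f (x i)|) * S 2 x := by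
    -- nonnegativity of `W` from the bound at `k = 1`
    have h1 := (h 1).2
    have hnn : 0 ≤ ∫ ω : FieldConfig (EuclideanSpace ℝ (Fin 3)), (ω f) ^ (2 * 1) ∂μ :=
      integral_nonneg fun ω => (even_two_mul 1).pow_nonneg _
    have hc : ((2 * 1)! : ℝ) / (2 ^ 1 * (1 : ℕ)!) = 1 := by norm_num [Nat.factorial]
    rw [hc, one_mul, pow_one] at h1
    exact hnn.trans h1
  have hi := integrable_exp_mul_of_even_moments (P := μ) (measurable_eval f) hW (fun k => (h k).1)
    (fun k => (h k).2) 1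
  simpa using hi

/-! ### The moment densities of the limit are the scaling limit -/

/-- **Moment densities of the limit law**: `E_μ[∏ᵢ ω(fᵢ)] = ∫ (∏ᵢ fᵢ(xᵢ)) Sₙ(x) dx` for all `n`
and all test functions (weak convergence of the `n`-dimensional marginals and uniform square
integrability of the product, `(∏ᵢ yᵢ)² ≤ Σᵢ yᵢ^{2n}`). [cite: GlimmJaffe1987, §6.1] -/
theorem moment_limitLaw_eq (hlim : HasPointwiseScalingLimit (criticalCorr 3) ρ S)
    (hnd : IsNondegenerateTwoPoint S) (hsc : IsScaleCovariant Δ S) (hΔ0 : 0 < Δ) (hΔ : Δ < 3 / 2)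
    (hν : ∀ A : Finset (Site 3), spinCorr ν A = plusCorr 3 (criticalBeta 3) 0 A)
    (hL : Tendsto (fun δ => δ * L δ) (𝓝[>] 0) atTop)
    (hlaw : TendstoInLaw (fun δ => spinFieldLaw ν (box 3 (L δ)) δ (ρ δ)) (𝓝[>] 0) μ)
    {n : ℕ} (f : Fin n → SchwartzMap (EuclideanSpace ℝ (Fin 3)) ℝ) :
    moment μ n f = ∫ x : Fin n → EuclideanSpace ℝ (Fin 3), (∏ i, f i (x i)) * S n x := by
  rcases Nat.eq_zero_or_pos n with rfl | hn
  · -- `n = 0`: both sides are `1`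
    have hS0 : S 0 = fun _ => 1 := by
      funext x
      have hx : x ∈ NonCoincident 3 0 := fun i => i.elim0
      have ht := (hlim 0).tendsto_at hx
      have h1 : (fun δ : ℝ => rescaledCorrelator (criticalCorr 3) ρ 0 δ x) = fun _ => 1 := by
        funext δ
        rw [rescaledCorrelator_apply, pow_zero, one_mul]
        change plusExpect 3 (criticalBeta 3) 0 (spinMonomial _) = 1
        have : (spinMonomial (fun i : Fin 0 => latticeApprox δ (x i)) : SpinConfig (Site 3) → ℝ) =
            fun _ => 1 := by funext s; simp [spinMonomial]
        rw [this]
        exact Literature.Barriers.CriticalPhenomena.plusExpect_const 3 _ 0 1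
      rw [h1] at ht
      exact tendsto_nhds_unique tendsto_const_nhds ht |>.symm ▸ rfl
    unfold moment
    -- the volume of `Fin 0 → ℝ³` is `1`
    have hvol : (volume : Measure (Fin 0 → EuclideanSpace ℝ (Fin 3))).real Set.univ = 1 := by
      rw [volume_pi, Measure.real, Measure.pi_empty_univ, ENNReal.toReal_one]
    simp only [Finset.univ_eq_empty, Finset.prod_empty, hS0, mul_one, integral_const, probReal_univ,
      hvol, smul_eq_mul]
  -- `n ≥ 1`
  have hfdd := tendsto_map_fddMap hlaw f
  set g : (Fin n → ℝ) → ℝ := fun y => ∏ i, y i with hg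
  have hgc : Continuous g := continuous_finsetProd _ fun i _ => continuous_apply i
  -- Gaussian bounds for each `fᵢ`, simultaneously
  have hev : ∀ᶠ δ in 𝓝[>] (0 : ℝ), ∀ i, ∀ k : ℕ,
      ∫ ω, (ω (f i)) ^ (2 * k) ∂(spinFieldLaw ν (box 3 (L δ)) δ (ρ δ)) ≤
        ((2 * k)! : ℝ) / (2 ^ k * k !) *
          (1 + ∫ x : Fin 2 → EuclideanSpace ℝ (Fin 3), (∏ j, |f i (x j)|) * S 2 x) ^ k :=
    eventually_all.2 fun i => (eventually_even_moment_le hlim hnd hsc hΔ0 hΔ hν hL (f i)).mono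
      fun δ h k => (h k).2
  set K : ℝ := ∑ i, ((2 * n)! : ℝ) / (2 ^ n * n !) *
    (1 + ∫ x : Fin 2 → EuclideanSpace ℝ (Fin 3), (∏ j, |f i (x j)|) * S 2 x) ^ n with hK
  have hmapP : ∀ δ, ∀ F : (Fin n → ℝ) → ℝ, Continuous F →
      ∫ y, F y ∂((ProbabilityMeasure.map ⟨spinFieldLaw ν (box 3 (L δ)) δ (ρ δ), inferInstance⟩ (measurable_fddMap f).aemeasurable : ProbabilityMeasure (Fin n → ℝ)) : Measure (Fin n → ℝ)) =
        ∫ ω, F (fddMap f ω) ∂(spinFieldLaw ν (box 3 (L δ)) δ (ρ δ)) := by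
    intro δ F hF
    rw [ProbabilityMeasure.toMeasure_map]
    exact integral_map (measurable_fddMap _).aemeasurable hF.aestronglyMeasurable
  have hbound : ∀ᶠ δ in 𝓝[>] (0 : ℝ), Integrable (fun y => g y ^ 2)
      ((ProbabilityMeasure.map ⟨spinFieldLaw ν (box 3 (L δ)) δ (ρ δ), inferInstance⟩ (measurable_fddMap f).aemeasurable : ProbabilityMeasure (Fin n → ℝ)) : Measure (Fin n → ℝ)) ∧
      ∫ y, g y ^ 2 ∂((ProbabilityMeasure.map ⟨spinFieldLaw ν (box 3 (L δ)) δ (ρ δ), inferInstance⟩ (measurable_fddMap f).aemeasurable : ProbabilityMeasure (Fin n → ℝ)) : Measure (Fin n → ℝ)) ≤ K := by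
    filter_upwards [hev] with δ hδ
    -- every polynomial in the `ω(fᵢ)` is bounded, hence integrable, under `P_δ`
    have hintP : ∀ (F : (Fin n → ℝ) → ℝ), Continuous F → (∃ C, ∀ σ : SpinConfig (Site 3),
        |F (fun i => spinField (box 3 (L δ)) δ (ρ δ) σ (f i))| ≤ C) →
        Integrable (fun ω => F (fddMap f ω)) (spinFieldLaw ν (box 3 (L δ)) δ (ρ δ)) := by
      intro F hF ⟨C, hC⟩
      unfold spinFieldLaw
      refine (integrable_map_measure (hF.comp_aestronglyMeasurable
        (measurable_fddMap f).aestronglyMeasurable) (measurable_spinField _ δ (ρ δ)).aemeasurable).2 ?_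
      refine Integrable.of_bound ((hF.measurable.comp ((measurable_fddMap f).comp
        (measurable_spinField _ δ (ρ δ)))).aestronglyMeasurable) C (Eventually.of_forall fun σ => ?_)
      rw [Real.norm_eq_abs]
      exact hC σ
    have hsq : Integrable (fun ω => g (fddMap f ω) ^ 2) (spinFieldLaw ν (box 3 (L δ)) δ (ρ δ)) := by
      refine hintP (fun y => g y ^ 2) (hgc.fun_pow 2) ⟨(∏ i, ∑ x ∈ box 3 (L δ),
        |ρ δ * δ ^ 3 * f i (δ • siteToE x)|) ^ 2, fun σ => ?_⟩
      simp only [hg]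
      rw [abs_pow, Finset.abs_prod]
      exact pow_le_pow_left₀ (Finset.prod_nonneg fun i _ => abs_nonneg _)
        (Finset.prod_le_prod (fun i _ => abs_nonneg _) fun i _ => abs_spinField_apply_le _ δ (ρ δ) σ (f i)) 2
    constructor
    · rw [ProbabilityMeasure.toMeasure_map]
      exact (integrable_map_measure (hgc.fun_pow 2).aestronglyMeasurable (measurable_fddMap _).aemeasurable).2 hsq
    · rw [hmapP δ _ (hgc.fun_pow 2)]
      have hpow : ∀ i, Integrable (fun ω => (ω (f i)) ^ (2 * n)) (spinFieldLaw ν (box 3 (L δ)) δ (ρ δ)) := by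
        intro i
        have := hintP (fun y => (y i) ^ (2 * n)) ((continuous_apply i).pow _)
          ⟨(∑ x ∈ box 3 (L δ), |ρ δ * δ ^ 3 * f i (δ • siteToE x)|) ^ (2 * n), fun σ => by
            rw [abs_pow]
            exact pow_le_pow_left₀ (abs_nonneg _) (abs_spinField_apply_le _ δ (ρ δ) σ (f i)) _⟩
        simpa [fddMap_apply] using this
      calc ∫ ω, g (fddMap f ω) ^ 2 ∂(spinFieldLaw ν (box 3 (L δ)) δ (ρ δ))
          ≤ ∫ ω, ∑ i, (ω (f i)) ^ (2 * n) ∂(spinFieldLaw ν (box 3 (L δ)) δ (ρ δ)) := by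
            refine integral_mono hsq (integrable_finsetSum _ fun i _ => hpow i) fun ω => ?_
            simp only [hg, fddMap_apply]
            rw [← Finset.prod_pow]
            calc ∏ i, (ω (f i)) ^ 2 ≤ ∑ i, ((ω (f i)) ^ 2) ^ n :=
                  prod_le_sum_pow hn (fun i => (ω (f i)) ^ 2) fun i => sq_nonneg _
              _ = ∑ i, (ω (f i)) ^ (2 * n) := by simp_rw [← pow_mul]
        _ = ∑ i, ∫ ω, (ω (f i)) ^ (2 * n) ∂(spinFieldLaw ν (box 3 (L δ)) δ (ρ δ)) :=
            integral_finsetSum _ fun i _ => hpow i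
        _ ≤ K := Finset.sum_le_sum fun i _ => hδ i n
  have hT := tendsto_integral_of_forall_sq_integral_le hfdd hgc hbound
  -- identify both sides
  have hlhs : ∫ y, g y ∂((ProbabilityMeasure.map ⟨μ, inferInstance⟩ (measurable_fddMap f).aemeasurable : ProbabilityMeasure (Fin n → ℝ)) : Measure (Fin n → ℝ)) =
      moment μ n f := by
    rw [ProbabilityMeasure.toMeasure_map, integral_map (measurable_fddMap _).aemeasurable
      hgc.aestronglyMeasurable]
    unfold moment
    simp only [hg, fddMap_apply, ProbabilityMeasure.coe_mk]
  have hrhs : ∀ δ, ∫ y, g y ∂((ProbabilityMeasure.map ⟨spinFieldLaw ν (box 3 (L δ)) δ (ρ δ), inferInstance⟩ (measurable_fddMap f).aemeasurable : ProbabilityMeasure (Fin n → ℝ)) : Measure (Fin n → ℝ)) =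
      moment (spinFieldLaw ν (box 3 (L δ)) δ (ρ δ)) n f := by
    intro δ
    rw [hmapP δ _ hgc]
    unfold moment
    simp only [hg, fddMap_apply]
  rw [hlhs] at hT
  simp_rw [hrhs] at hT
  exact tendsto_nhds_unique hT (tendsto_moment_spinFieldLaw hlim hnd hsc hΔ0 hΔ hν hL f)

end Summit.CriticalPhenomena.Ising3DConformalLimit.MarkovRigidityFieldRealisation

end
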